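import Summits.AnomalousDissipation.AnomalousDissipation.Theorems.SawtoothPulseCascadeK1LocalisedCascadeSymbolFibreTools

/-!
# K1loc, line `Spectral` / SeqCone — helper: FIBRE DATA OF THE ENVELOPE FACTOR (S-B symbol data for the product symbol)

Helper file of the prover lane on the crux `K1LocalisedCascade` (stmt-AnomalousDissipation-19491), route
`SawtoothPulseCascade` (glue seat k1loc-p3; companion of `…SymbolProduct`).  The tracked symbol `μ̂ = 1 − g·g_env` multiplies
a cone–radial indicator `g` by the envelope `g_env(k_a,k_c) = (1 − sT((|k_a| − R)/w))(1 − sT((|k_c| − R)/w))` of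
`…SymbolLattice`.  Along a fibre (one coordinate `= n` fixed, the other `= t`, possibly shifted by a branch shift `t₀`) the
envelope factor is `E(t) = c·(1 − sT((|t − t₀| − R)/w))` with the constant `c = 1 − sT((|n| − R)/w) ∈ [0,1]`.  This file gives
its fibre data in the shape consumed by the combinators `…K1Symbol.abs_iteratedDeriv_one_sub_mul[_sq]_le_of_scale`:
`contDiff_envFactor` and `exists_bound_iteratedDeriv_envFactor` — for every order `i` a constant `C_i ≥ 0` (depending on `i`
only) with `|E⁽ⁱ⁾(t)| ≤ C_i/bⁱ` whenever `0 ≤ c ≤ 1`, `R, w > 0`, `0 < b ≤ w`.  No definitions; no statement about the stub.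
[cite: Grafakos2014, Prop. 3.1.2 (5)] [problem: turb]
-/

-- `Summit.<Summit>.<Problem>`: single-conjunct summit, the duplicate namespace segment is deliberate.
set_option linter.dupNamespace false

noncomputable section

namespace Summit.AnomalousDissipation.AnomalousDissipation.Theorems.SawtoothPulseCascade.K1Cutoff

open Set Filter Topology Real
open scoped ContDiff

/-- The envelope factor `E(t) = c·(1 − sT((|t − t₀| − R)/w))` is smooth (`R, w > 0`). [folklore] -/
theorem contDiff_envFactor {R w : ℝ} (hR : 0 < R) (hw : 0 < w) (c t₀ : ℝ) {m : ℕ∞} :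
    ContDiff ℝ m (fun t : ℝ => c * (1 - smoothTransition ((|t - t₀| - R) / w))) := by
  have h : ContDiff ℝ m (fun t : ℝ => smoothTransition ((|t| - R) / w)) :=
    contDiff_iff_contDiffAt.2 fun t => contDiffAt_smoothTransition_affine_abs hR hw t
  exact contDiff_const.mul (contDiff_const.sub (h.comp (contDiff_id.sub contDiff_const)))

/-- **Fibre data of the envelope factor**: for every `i` there is `C_i ≥ 0` with `|E⁽ⁱ⁾(t)| ≤ C_i/bⁱ` for all `0 ≤ c ≤ 1`,
`R, w > 0`, `0 < b ≤ w`, `t₀, t` (`E(t) = c·(1 − sT((|t − t₀| − R)/w))`). [cite: Grafakos2014, Prop. 3.1.2 (5)] -/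
theorem exists_bound_iteratedDeriv_envFactor (i : ℕ) :
    ∃ C : ℝ, 0 ≤ C ∧ ∀ {c R w b : ℝ}, 0 ≤ c → c ≤ 1 → 0 < R → 0 < w → 0 < b → b ≤ w → ∀ (t₀ t : ℝ),
      |iteratedDeriv i (fun t : ℝ => c * (1 - smoothTransition ((|t - t₀| - R) / w))) t| ≤ C / b ^ i := by
  obtain ⟨C, hC0, hC⟩ := exists_bound_iteratedDeriv_smoothTransition i
  refine ⟨C + 1, by linarith, ?_⟩
  intro c R w b hc0 hc1 hR hw hb hbw t₀ t
  rcases Nat.eq_zero_or_pos i with rfl | hi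
  · rw [iteratedDeriv_zero, pow_zero, div_one, abs_mul, abs_of_nonneg hc0]
    have h0 := Real.smoothTransition.nonneg ((|t - t₀| - R) / w)
    have h1 := Real.smoothTransition.le_one ((|t - t₀| - R) / w)
    calc c * |1 - smoothTransition ((|t - t₀| - R) / w)| ≤ 1 * 1 :=
          mul_le_mul hc1 (by rw [abs_le]; constructor <;> linarith) (abs_nonneg _) zero_le_one
      _ ≤ C + 1 := by linarith
  · -- `E⁽ⁱ⁾ = −c·(sT((|· − t₀| − R)/w))⁽ⁱ⁾`, a translate of the landed abs-affine step bound
    have hsm : ContDiff ℝ ∞ (fun t : ℝ => smoothTransition ((|t - t₀| - R) / w)) :=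
      (contDiff_iff_contDiffAt.2 fun t => contDiffAt_smoothTransition_affine_abs hR hw t).comp
        (contDiff_id.sub contDiff_const)
    have hsub : ContDiffAt ℝ i (fun t : ℝ => 1 - smoothTransition ((|t - t₀| - R) / w)) t :=
      ((contDiff_const.sub hsm).of_le (by exact_mod_cast le_top)).contDiffAt
    rw [iteratedDeriv_const_mul c hsub, iteratedDeriv_const_sub hi, iteratedDeriv_neg, abs_mul, abs_neg, abs_of_nonneg hc0]
    have hshift : iteratedDeriv i (fun t : ℝ => smoothTransition ((|t - t₀| - R) / w)) t =
        iteratedDeriv i (fun t : ℝ => smoothTransition ((|t| - R) / w)) (t - t₀) := by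
      rw [iteratedDeriv_comp_sub_const i (fun t : ℝ => smoothTransition ((|t| - R) / w)) t₀]
    rw [hshift]
    have h := abs_iteratedDeriv_smoothTransition_affine_abs_le hC hR hw (t - t₀)
    have hbw' : C / w ^ i ≤ C / b ^ i :=
      div_le_div_of_nonneg_left hC0 (pow_pos hb i) (pow_le_pow_left₀ hb.le hbw i)
    calc c * |iteratedDeriv i (fun t : ℝ => smoothTransition ((|t| - R) / w)) (t - t₀)| ≤ 1 * (C / b ^ i) :=
          mul_le_mul hc1 (h.trans hbw') (abs_nonneg _) zero_le_one
      _ ≤ (C + 1) / b ^ i := by rw [one_mul]; exact div_le_div_of_nonneg_right (by linarith) (pow_pos hb i).le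

end Summit.AnomalousDissipation.AnomalousDissipation.Theorems.SawtoothPulseCascade.K1Cutoff
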